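import Literature.Probability.LatticeModels.PlaneRotatorTorusBoxCriterion
import Literature.Probability.LatticeModels.LayeredPlaneRotatorSusceptibility
import HarnessLib

/-!
# The susceptibility transition of the plane rotator does not depend on the boundary condition:
# `sup_L χ^{per}_L(K) < ∞ ⇔ ∑_x G^{free,∞}_K(0,x) < ∞ ⇔` Lieb's algorithm terminates

Topic `Literature/Probability/LatticeModels`. J. Ginibre, Comm. Math. Phys. **16** (1970) 310 (two-point functions of
plane rotators are non-decreasing in the ferromagnetic couplings: the torus dominates every free box it contains)
[Ginibre1970]; E. H. Lieb, Comm. Math. Phys. **77** (1980) 127, eq. (23), Theorem 4 and p. 128 (boxes: the finite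
algorithm) and B. Simon, ibid. 111, Thm 1.3 [Lieb1980] [Simon1980CMP]; S. Friedli, Y. Velenik, *Statistical Mechanics of
Lattice Systems* (CUP 2017), §3.1 (boxes, periodic boundary condition) [FriedliVelenik2017].

Two objects of the tree meet here. The FREE object: `volTwoPoint K ν Λ` / `infTwoPoint K ν x y = sup_n
⟨cos(θ_x − θ_y)⟩^{free}_{[−n,n]^ν, K}` (`PlaneRotatorFreeTwoPoint.lean`, with the Simon–Lieb dichotomy
`summable_infTwoPoint_iff : ∑_x G^{free,∞}_K(0,x) < ∞ ⇔ ∃R, S_R(K) < 1` on `ℤ²`). The PERIODIC object: the Gibbs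
expectation `⟨cos(θ_x − θ_y)⟩_{K,L}` of the bond system `torusXY d L` (`BondSystem.expectJ`), on which the helicity
modulus `torusXYStiffness` and the reflection-positivity floors live, and for which the tree holds Lieb's box criterion
with the SAME free-box numbers (`torusXY_expectJ_cosDiff_le_pow_nnBoxShellSum`, `PlaneRotatorTorusBoxCriterion.lean`).

* §1 **Ginibre: a free box inside the torus** (`volTwoPoint_box_le_torusXY_expectJ`): for `2n < L` and `x, y ∈
  [−n,n]^d`, `⟨cos(θ_x − θ_y)⟩^{free}_{[−n,n]^d, K} ≤ ⟨cos(θ_{πx} − θ_{πy})⟩_{K,L}` (embedding comparison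
  `twoPoint_le_of_embedding`; `π` the reduction mod `L`, injective on the box); summed:
  `∑_{x ∈ [−n,n]^d} G^{free}_{[−n,n]^d}(0,x) ≤ χ^{per}_L(K) := ∑_y ⟨cos(θ_0 − θ_y)⟩_{K,L}`.
* §2 **Bounded periodic susceptibility ⇒ summable free two-point function**
  (`summable_infTwoPoint_of_torus_susceptibility_le`): if `χ^{per}_L(K) ≤ B` for all large `L` then
  `∑_x G^{free,∞}_K(0,x) ≤ B` (monotone convergence of the free boxes, `tendsto_volTwoPoint_box`).
* §3 **Lieb's algorithm ⇒ bounded periodic susceptibility** (`sum_torusXY_expectJ_cosDiff_le_tsum`): if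
  `S_R(K) ≤ m < 1` then `χ^{per}_L(K) ≤ ∑_{z ∈ ℤ^d} m^{⌊‖z‖_∞/R⌋}` for every `L ≥ 2R + 2` (the torus box criterion summed
  in box coordinates; lattice sum `summable_pow_supNorm_div`).
* §4 **The equivalence on `ℤ²`** (`torus_susceptibility_bounded_iff_summable_infTwoPoint`,
  `torus_susceptibility_bounded_iff_exists_nnBoxShellSum_lt_one`): `χ^{per}_L(K)` eventually bounded in `L` ⇔
  `∑_x G^{free,∞}_K(0,x) < ∞` ⇔ `∃R ≥ 1, S_R(K) < 1`. Corollaries: it holds for every `K < log(1+√2)` (tree's Onsager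
  window) and fails wherever the helicity modulus does not vanish, `βΥ_L(K) ↛ 0 ⇒ χ^{per}_L(K)` unbounded
  (`torus_susceptibility_unbounded_of_not_tendsto_torusXYStiffness`) — now a statement about two PERIODIC objects.

In words (classical comparison model of the `hubbard-tc` cell, crux №2 classical side / 2D→3D grammar): the
susceptibility transition temperature `T_χ` of the two-dimensional plane rotator is the same number for periodic boxes,
for free boxes in infinite volume, and for Lieb's finite algorithm; `T_Υ ≤ T_χ` reads on the torus alone.

## What this is not

Classical comparison model only; no number asserted (the certified `S_2(0.663) < 1 < S_2(0.664)` is not in the kernel);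
nothing about the Kosterlitz–Thouless point itself (`T_Υ = T_χ` is not claimed); nothing electronic.
-/

noncomputable section

open MeasureTheory Finset Filter
open scoped BigOperators Topology

namespace Literature.Probability.LatticeModels

open PlaneRotator Literature.Barriers.CriticalPhenomena Literature.Barriers.CriticalPhenomena.LongRangeIsing
open Literature.MathematicalPhysics.QuantumLattice

variable {d L : ℕ} [NeZero L] [MeasurableSpace Circle] [BorelSpace Circle]

/-! ## §1 Ginibre: a free box inside the torus -/

section FreeInTorus

omit [MeasurableSpace Circle] [BorelSpace Circle] in
/-- **A nearest-neighbour pair of `ℤ^d` projects to a pair joined by a torus bond, so the symmetrised torus coupling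
there is at least `K/2`** (`K ≥ 0`). [cite: Ginibre1970, Prop. 3 with Example 4 (plane rotators; comparison of couplings)] -/
theorem half_le_torusXY_symmCoupling_proj_of_nn {K : ℝ} (hK : 0 ≤ K) {x y : Site d} (hxy : nnCoupling d x y = 1) :
    K / 2 ≤ symmCoupling ((torusXY d L).pairCoupling fun _ => K) (Torus.proj L x, Torus.proj L y) := by
  classical
  have h1 : l1Norm (x - y) = 1 := by
    unfold nnCoupling at hxy
    by_contra h
    rw [if_neg h] at hxy
    exact zero_ne_one hxy
  obtain ⟨i, hi⟩ := eq_single_or_of_l1Norm_eq_one h1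
  rw [torusXY_symmCoupling_pairCoupling]
  have hA : 0 ≤ ∑ j : Fin d, if Torus.proj L x + Pi.single j 1 = Torus.proj L y then (1 : ℝ) else 0 :=
    torusXY_nbr_nonneg _ _
  have hB : 0 ≤ ∑ j : Fin d, if Torus.proj L y + Pi.single j 1 = Torus.proj L x then (1 : ℝ) else 0 :=
    torusXY_nbr_nonneg _ _
  rcases hi with hi | hi
  · -- `x = y + eᵢ`: the bond `(πy, i)` points to `πx`
    have hx : x = y + Pi.single i 1 := by rw [← hi]; abel
    have hterm : (1 : ℝ) ≤ ∑ j : Fin d, if Torus.proj L y + Pi.single j 1 = Torus.proj L x then (1 : ℝ) else 0 := by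
      have h := Finset.single_le_sum (f := fun j : Fin d =>
          if Torus.proj L y + Pi.single j 1 = Torus.proj L x then (1 : ℝ) else 0)
        (fun j _ => by split_ifs <;> norm_num) (Finset.mem_univ i)
      rwa [if_pos (by rw [hx, torusProj_add_single_one])] at h
    nlinarith
  · -- `y = x + eᵢ`: the bond `(πx, i)` points to `πy`
    have hy : y = x + Pi.single i 1 := by
      have : x - y = -Pi.single i 1 := hi
      rw [sub_eq_iff_eq_add] at this; rw [this]; abel
    have hterm : (1 : ℝ) ≤ ∑ j : Fin d, if Torus.proj L x + Pi.single j 1 = Torus.proj L y then (1 : ℝ) else 0 := by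
      have h := Finset.single_le_sum (f := fun j : Fin d =>
          if Torus.proj L x + Pi.single j 1 = Torus.proj L y then (1 : ℝ) else 0)
        (fun j _ => by split_ifs <;> norm_num) (Finset.mem_univ i)
      rwa [if_pos (by rw [hy, torusProj_add_single_one])] at h
    nlinarith

/-- **Ginibre's comparison: a free box inside the torus.** For `K ≥ 0`, `2n < L` and `x, y ∈ [−n,n]^d`:

  `⟨cos(θ_x − θ_y)⟩^{free}_{[−n,n]^d, K} ≤ ⟨cos(θ_{πx} − θ_{πy})⟩_{K,L}`,

`π` the reduction mod `L` (injective on the box): the torus model is the free box plus further ferromagnetic bonds and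
further rotators (embedding comparison `twoPoint_le_of_embedding`). [cite: Ginibre1970, Prop. 3 with Example 4 (plane rotators); FriedliVelenik2017, §3.1 (boxes, periodic boundary condition)] -/
theorem volTwoPoint_box_le_torusXY_expectJ {K : ℝ} (hK : 0 ≤ K) {n : ℕ} (hL : 2 * n < L) {x y : Site d}
    (hx : x ∈ box d n) (hy : y ∈ box d n) :
    volTwoPoint K d (box d n) x y ≤
      (torusXY d L).expectJ (fun _ => K) (cosDiff (Torus.proj L x) (Torus.proj L y)) := by
  rw [volTwoPoint_of_mem K hx hy, (torusXY d L).expectJ_cosDiff_eq_twoPoint,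
    ← twoPoint_symmCoupling ((torusXY d L).pairCoupling fun _ => K)]
  have hinj : Function.Injective fun z : box d n => Torus.proj L (z : Site d) := fun u v huv =>
    Subtype.ext (torusProj_injOn_box_of_lt hL u.2 v.2 huv)
  refine twoPoint_le_of_embedding (τ := fun z : box d n => Torus.proj L (z : Site d)) hinj
    (J₀ := nnXYCoupling K d (box d n)) (fun q => ?_) (torusXY_symmCoupling_nonneg hK) (fun u v => ?_)
    ⟨x, hx⟩ ⟨y, hy⟩
  · exact mul_nonneg (div_nonneg hK zero_le_two) (nnCoupling_nonneg _ _)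
  · show K / 2 * nnCoupling d (u : Site d) (v : Site d) ≤ _
    by_cases h1 : nnCoupling d (u : Site d) (v : Site d) = 1
    · rw [h1, mul_one]
      exact half_le_torusXY_symmCoupling_proj_of_nn hK h1
    · have h0 : nnCoupling d (u : Site d) (v : Site d) = 0 := by
        unfold nnCoupling at h1 ⊢; split_ifs with h <;> simp_all
      rw [h0, mul_zero]
      exact torusXY_symmCoupling_nonneg hK _

/-- **The free-box susceptibility is below the periodic one**: for `K ≥ 0` and `2n < L`,
`∑_{x ∈ [−n,n]^d} ⟨cos(θ_0 − θ_x)⟩^{free}_{[−n,n]^d} ≤ χ^{per}_L(K) = ∑_y ⟨cos(θ_0 − θ_y)⟩_{K,L}`.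
[cite: Ginibre1970, Prop. 3 with Example 4 (plane rotators); FriedliVelenik2017, §3.1 (boxes, periodic boundary condition)] -/
theorem sum_volTwoPoint_box_le_torus_susceptibility {K : ℝ} (hK : 0 ≤ K) {n : ℕ} (hL : 2 * n < L) :
    ∑ x ∈ box d n, volTwoPoint K d (box d n) 0 x ≤
      ∑ y : TorusSite d L, (torusXY d L).expectJ (fun _ => K) (cosDiff 0 y) := by
  classical
  have hinj : Set.InjOn (Torus.proj (d := d) L) (box d n : Set (Site d)) := torusProj_injOn_box_of_lt hL
  have h0 : Torus.proj L (0 : Site d) = (0 : TorusSite d L) := by funext i; simp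
  calc ∑ x ∈ box d n, volTwoPoint K d (box d n) 0 x
      ≤ ∑ x ∈ box d n, (torusXY d L).expectJ (fun _ => K) (cosDiff 0 (Torus.proj L x)) := by
        refine Finset.sum_le_sum fun x hx => ?_
        have h := volTwoPoint_box_le_torusXY_expectJ (L := L) hK hL (zero_mem_box d n) hx
        rwa [h0] at h
    _ = ∑ y ∈ (box d n).image (Torus.proj L), (torusXY d L).expectJ (fun _ => K) (cosDiff 0 y) := by
        rw [Finset.sum_image hinj]
    _ ≤ ∑ y : TorusSite d L, (torusXY d L).expectJ (fun _ => K) (cosDiff 0 y) := by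
        refine Finset.sum_le_sum_of_subset_of_nonneg (Finset.subset_univ _) fun y _ _ => ?_
        rw [(torusXY d L).expectJ_cosDiff_eq_twoPoint]
        exact twoPoint_nonneg ((torusXY d L).pairCoupling_nonneg fun _ => hK) _ _

end FreeInTorus

/-! ## §2 Bounded periodic susceptibility ⇒ summable free two-point function -/

section PeriodicToFree

omit [NeZero L] in
/-- **Eventually bounded periodic susceptibility bounds the infinite-volume free susceptibility.** If
`χ^{per}_L(K) ≤ B` for all `L ≥ L₀`, then `∑_x G^{free,∞}_K(0,x)` converges and is `≤ B` (the free boxes increase to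
`G^{free,∞}`, and each sits inside a large torus). [cite: Ginibre1970, Prop. 3 with Example 4 (plane rotators); Simon1980CMP, Thm 1.3 (summable two-point function)] -/
theorem summable_infTwoPoint_of_torus_susceptibility_le {K : ℝ} (hK : 0 ≤ K) {B : ℝ} {L₀ : ℕ}
    (h : ∀ (L : ℕ) [NeZero L], L₀ ≤ L →
      ∑ y : TorusSite d L, (torusXY d L).expectJ (fun _ => K) (cosDiff 0 y) ≤ B) :
    Summable (fun x : Site d => infTwoPoint K d 0 x) ∧ ∑' x : Site d, infTwoPoint K d 0 x ≤ B := by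
  classical
  -- partial sums over any finite set are `≤ B`
  have hpart : ∀ F : Finset (Site d), ∑ x ∈ F, infTwoPoint K d 0 x ≤ B := by
    intro F
    -- the limit of the box two-point functions, summed over `F`
    have hlim : Tendsto (fun n : ℕ => ∑ x ∈ F, volTwoPoint K d (box d n) 0 x) atTop
        (𝓝 (∑ x ∈ F, infTwoPoint K d 0 x)) :=
      tendsto_finsetSum F fun x _ => tendsto_volTwoPoint_box hK 0 x
    refine le_of_tendsto' hlim fun n => ?_
    -- a torus of side `L = max (2n+1) L₀` contains the box `[−n,n]^d` injectively
    set L : ℕ := max (2 * n + 1) (max L₀ 1) with hLdef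
    haveI : NeZero L := ⟨by positivity⟩
    have hL : 2 * n < L := lt_of_lt_of_le (Nat.lt_succ_self _) (le_max_left _ _)
    have hL₀ : L₀ ≤ L := le_trans (le_max_left _ _) (le_max_right _ _)
    calc ∑ x ∈ F, volTwoPoint K d (box d n) 0 x
        ≤ ∑ x ∈ box d n, volTwoPoint K d (box d n) 0 x := by
          -- terms outside the box vanish; terms are non-negative
          rw [← Finset.sum_filter_add_sum_filter_not F (fun x => x ∈ box d n)]
          have hzero : ∑ x ∈ F.filter (fun x => x ∉ box d n), volTwoPoint K d (box d n) 0 x = 0 :=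
            Finset.sum_eq_zero fun x hx => by
              unfold volTwoPoint
              rw [dif_neg (fun h => (Finset.mem_filter.1 hx).2 h.2)]
          rw [hzero, add_zero]
          exact Finset.sum_le_sum_of_subset_of_nonneg (fun x hx => (Finset.mem_filter.1 hx).2)
            fun x _ _ => volTwoPoint_nonneg hK _ _ _
      _ ≤ ∑ y : TorusSite d L, (torusXY d L).expectJ (fun _ => K) (cosDiff 0 y) :=
          sum_volTwoPoint_box_le_torus_susceptibility hK hL
      _ ≤ B := h L hL₀
  have hsum : Summable (fun x : Site d => infTwoPoint K d 0 x) :=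
    summable_of_sum_le (fun x => infTwoPoint_nonneg hK 0 x) hpart
  exact ⟨hsum, hsum.tsum_le_of_sum_le hpart⟩

end PeriodicToFree

/-! ## §3 Lieb's algorithm ⇒ bounded periodic susceptibility -/

section FreeToPeriodic

/-- **One terminating box bounds the periodic susceptibility, uniformly in the volume**: if `S_R(K) ≤ m < 1` (`R ≥ 1`,
`K ≥ 0`) then for every `L ≥ 2R + 2` and every site `x`,
`∑_y ⟨cos(θ_x − θ_y)⟩_{K,L} ≤ ∑_{z ∈ ℤ^d} m^{⌊‖z‖_∞/R⌋}` (torus box criterion in box coordinates; the lattice sum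
converges). [cite: Lieb1980, Theorem 4 and p. 128 (boxes; finite algorithm); Simon1980CMP, Thm 1.3 (exponential decay summed over the lattice)] -/
theorem sum_torusXY_expectJ_cosDiff_le_tsum {K : ℝ} (hK : 0 ≤ K) {R : ℕ} (hR : 1 ≤ R) (hL : 2 * R + 2 ≤ L)
    {m : ℝ} (hSm : nnBoxShellSum K d R ≤ m) (hm1 : m < 1) (x : TorusSite d L) :
    ∑ y : TorusSite d L, (torusXY d L).expectJ (fun _ => K) (cosDiff x y) ≤
      ∑' z : Site d, m ^ (Site.supNorm z / R) := by
  classical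
  have hS0 : 0 ≤ nnBoxShellSum K d R :=
    boxShellSum_nonneg (fun u v => mul_nonneg (div_nonneg hK zero_le_two) (nnCoupling_nonneg _ _)) R
  have hm0 : 0 ≤ m := hS0.trans hSm
  have hsum := summable_pow_supNorm_div (ν := d) hR hm0 hm1
  set τ : TorusSite d L → Site d := fun y i => ((y - x) i).valMinAbs with hτ
  have hτinj : Function.Injective τ := torusBoxCoord_injective x
  calc ∑ y : TorusSite d L, (torusXY d L).expectJ (fun _ => K) (cosDiff x y)
      ≤ ∑ y : TorusSite d L, m ^ (Site.supNorm (τ y) / R) := by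
        refine Finset.sum_le_sum fun y _ => ?_
        refine (torusXY_expectJ_cosDiff_le_pow_nnBoxShellSum hR hL hK x y).trans ?_
        rw [torusDist_comm', ← supNorm_torusBoxCoord x y]
        exact pow_le_pow_left₀ hS0 hSm _
    _ = ∑ z ∈ Finset.univ.image τ, m ^ (Site.supNorm z / R) := by
        rw [Finset.sum_image fun y _ z _ h => hτinj h]
    _ ≤ ∑' z : Site d, m ^ (Site.supNorm z / R) :=
        hsum.sum_le_tsum _ fun z _ => pow_nonneg hm0 _

end FreeToPeriodic

/-! ## §4 The equivalence on `ℤ²`, and its corollaries -/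

section Equivalence

omit [NeZero L] in
/-- **Boundary-condition independence of the susceptibility transition (`ℤ²`).** For `K ≥ 0`:
`χ^{per}_L(K) = ∑_y ⟨cos(θ_0 − θ_y)⟩_{K,L}` is bounded for all large `L` **iff** the infinite-volume free two-point
function is summable, `∑_x G^{free,∞}_K(0,x) < ∞`. (⇒: Ginibre, free boxes inside tori; ⇐: Simon–Lieb, a summable
free two-point function terminates Lieb's algorithm, whose box criterion holds on the torus with the same number.)
[cite: Ginibre1970, Prop. 3 with Example 4 (plane rotators); Lieb1980, Theorem 4 and p. 128 (boxes; finite algorithm); Simon1980CMP, Thm 1.3] -/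
theorem torus_susceptibility_bounded_iff_summable_infTwoPoint {K : ℝ} (hK : 0 ≤ K) :
    (∃ (B : ℝ) (L₀ : ℕ), ∀ (L : ℕ) [NeZero L], L₀ ≤ L →
        ∑ y : TorusSite 2 L, (torusXY 2 L).expectJ (fun _ => K) (cosDiff 0 y) ≤ B) ↔
      Summable (fun x : Site 2 => infTwoPoint K 2 0 x) := by
  constructor
  · rintro ⟨B, L₀, h⟩
    exact (summable_infTwoPoint_of_torus_susceptibility_le hK h).1
  · intro hG
    obtain ⟨R, hR, hS⟩ := exists_nnBoxShellSum_lt_one_of_summable hK hG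
    refine ⟨∑' z : Site 2, nnBoxShellSum K 2 R ^ (Site.supNorm z / R), 2 * R + 2, fun L _ hL => ?_⟩
    exact sum_torusXY_expectJ_cosDiff_le_tsum hK hR hL le_rfl hS 0

omit [NeZero L] in
/-- **… iff Lieb's finite algorithm terminates**: `χ^{per}_L(K)` eventually bounded ⇔ `∃ R ≥ 1, S_R(K) < 1`.
[cite: Lieb1980, Theorem 4 and p. 128 (boxes; finite algorithm); Simon1980CMP, Thm 1.3] -/
theorem torus_susceptibility_bounded_iff_exists_nnBoxShellSum_lt_one {K : ℝ} (hK : 0 ≤ K) :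
    (∃ (B : ℝ) (L₀ : ℕ), ∀ (L : ℕ) [NeZero L], L₀ ≤ L →
        ∑ y : TorusSite 2 L, (torusXY 2 L).expectJ (fun _ => K) (cosDiff 0 y) ≤ B) ↔
      ∃ R : ℕ, 1 ≤ R ∧ nnBoxShellSum K 2 R < 1 := by
  rw [torus_susceptibility_bounded_iff_summable_infTwoPoint hK, summable_infTwoPoint_iff hK]

omit [NeZero L] in
/-- **The periodic susceptibility is bounded throughout the Onsager window**: for `0 ≤ K < log(1+√2)` there are `B` and
`L₀` with `χ^{per}_L(K) ≤ B` for all `L ≥ L₀` (tree: Aizenman–Simon + Onsager ⇒ `∑_x G^{free,∞} < ∞`).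
[cite: AizenmanSimon1980RotorIsing, eq. (2); Lieb1980, Theorem 4 and p. 128 (boxes; finite algorithm)] -/
theorem torus_susceptibility_bounded_of_lt_log_one_add_sqrt_two {K : ℝ} (hK0 : 0 ≤ K)
    (hK : K < Real.log (1 + Real.sqrt 2)) :
    ∃ (B : ℝ) (L₀ : ℕ), ∀ (L : ℕ) [NeZero L], L₀ ≤ L →
      ∑ y : TorusSite 2 L, (torusXY 2 L).expectJ (fun _ => K) (cosDiff 0 y) ≤ B :=
  (torus_susceptibility_bounded_iff_summable_infTwoPoint hK0).2 (summable_infTwoPoint_of_lt_log_one_add_sqrt_two hK0 hK)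

omit [NeZero L] in
/-- **Where the helicity modulus survives, the periodic susceptibility diverges**: if `βΥ_{L+1}(K) ↛ 0` then for every
`B` and `L₀` there is `L ≥ L₀` with `χ^{per}_L(K) > B` — two periodic objects (tree: `Υ ↛ 0 ⇒` the free two-point
function is not summable; §2). [cite: Lieb1980, Theorem 4 and p. 128 (boxes); Simon1980CMP, Thm 1.3; Ginibre1970, Prop. 3 with Example 4 (plane rotators)] -/
theorem torus_susceptibility_unbounded_of_not_tendsto_torusXYStiffness {K : ℝ} (hK : 0 ≤ K)
    (hnot : ¬ Tendsto (fun L : ℕ => torusXYStiffness (L + 1) K) atTop (𝓝 0)) (B : ℝ) (L₀ : ℕ) :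
    ∃ (L : ℕ) (_ : NeZero L), L₀ ≤ L ∧
      B < ∑ y : TorusSite 2 L, (torusXY 2 L).expectJ (fun _ => K) (cosDiff 0 y) := by
  by_contra hcon
  push Not at hcon
  have hb : ∀ (L : ℕ) [NeZero L], L₀ ≤ L →
      ∑ y : TorusSite 2 L, (torusXY 2 L).expectJ (fun _ => K) (cosDiff 0 y) ≤ B :=
    fun L _ hL => hcon L inferInstance hL
  exact not_summable_infTwoPoint_of_not_tendsto_torusXYStiffness hK hnot
    (summable_infTwoPoint_of_torus_susceptibility_le hK hb).1

omit [NeZero L] in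
/-- **The free infinite-volume susceptibility is the supremum scale of the periodic ones**: if `∃R, S_R(K) ≤ m < 1` then
`∑_x G^{free,∞}_K(0,x) ≤ ∑_{z ∈ ℤ²} m^{⌊‖z‖_∞/R⌋}` (through the tori: §3 then §2) — the torus route to the free
susceptibility bound, same lattice sum as the periodic one. [cite: Lieb1980, Theorem 4 and p. 128 (boxes); Simon1980CMP, Thm 1.3; Ginibre1970, Prop. 3 with Example 4 (plane rotators)] -/
theorem tsum_infTwoPoint_le_tsum_pow_of_nnBoxShellSum_le {K : ℝ} (hK : 0 ≤ K) {R : ℕ} (hR : 1 ≤ R) {m : ℝ}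
    (hSm : nnBoxShellSum K 2 R ≤ m) (hm1 : m < 1) :
    Summable (fun x : Site 2 => infTwoPoint K 2 0 x) ∧
      ∑' x : Site 2, infTwoPoint K 2 0 x ≤ ∑' z : Site 2, m ^ (Site.supNorm z / R) :=
  summable_infTwoPoint_of_torus_susceptibility_le hK (L₀ := 2 * R + 2)
    fun _ _ hL => sum_torusXY_expectJ_cosDiff_le_tsum hK hR hL hSm hm1 0

end Equivalence

end Literature.Probability.LatticeModels

end
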